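import Literature.AlgebraicGeometry.Frobenioids.PerfFactorial
import HarnessLib

/-!
# Frobenioids I, §2: Definition 2.4 (i) — the two "`≤` iff" claims, proved

Mochizuki, *The geometry of Frobenioids I*, Kyushu J. Math. **62** (2008), Def. 2.4 (i), kurims
pp. 47–48 [cite: MochizukiFrdI2008, Def. 2.4(i) p.47].  Discharges two named statements of
`PerfFactorial.lean` for a perf-factorial monoid `M`:
* `PfLeIffFactor M` — "[if `a, b ∈ M^pf`, then an inequality `a ≤ b` holds in `M^pf` if and only if it
  holds in `M^pf_factor`]" (p. 47): from conditions (c) (homomorphism, injective, image in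
  `M^pf_factor`) and (d) (support criterion);
* `h.RlfLeIffFactor` — "if `a, b ∈ M^rlf`, then an inequality `a ≤ b` holds in `M^rlf` if and only if
  it holds in `M^rlf_factor`" (p. 48): the quotient has support inside `Supp(b)` because the factors
  `M^rlf_𝔮` are sharp.
-/

namespace Literature.AlgebraicGeometry.Frobenioids

universe u

variable {M : Type u} [CommMonoid M]

/-- **Def. 2.4 (i)(d), bracket** — PROVED: for perf-factorial `M` and `a, b ∈ M^pf`, `a ≤ b` in `M^pf`
iff `a ≤ b` in `M^pf_factor`. [cite: MochizukiFrdI2008, Def. 2.4(i) p.47] -/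
theorem pfLeIffFactor_holds (M : Type u) [CommMonoid M] : PfLeIffFactor M := by
  intro h a b
  constructor
  · rintro ⟨c, rfl⟩
    obtain ⟨x, hx⟩ := h.factorMap_mem_range c
    exact ⟨x, by rw [hx, h.factorMap_mul]⟩
  · rintro ⟨x, hx⟩
    -- the factor `x` has support inside `Supp(b)`, hence lies in `M^pf` by (d)
    have hsupp : supp (pfFactorToRlfFactor M x) ⊆ supp (factorMap M b) := by
      rw [← hx, mul_comm]
      exact supp_subset_supp_mul _ _
    obtain ⟨c, hc⟩ := h.mem_range_of_supp_subset x b hsupp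
    refine ⟨c, h.factorMap_injective ?_⟩
    rw [h.factorMap_mul, hc, hx]

/-- **Def. 2.4 (i), realification** — PROVED: for perf-factorial `M` and `a, b ∈ M^rlf`, `a ≤ b` in
`M^rlf` iff `a ≤ b` in `M^rlf_factor`. [cite: MochizukiFrdI2008, Def. 2.4(i) p.48] -/
theorem IsPerfFactorial.rlfLeIffFactor_holds (h : IsPerfFactorial M) : h.RlfLeIffFactor := by
  intro a b
  constructor
  · rintro ⟨c, rfl⟩
    exact ⟨c, rfl⟩
  · rintro ⟨c, hc⟩
    obtain ⟨b', hb'⟩ := b.2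
    -- `Supp(c) ⊆ Supp(b)`: if `b_𝔮 = 0` then `a_𝔮 + c_𝔮 = 0`, so `c_𝔮 = 0` (sharpness of `M^rlf_𝔮`)
    have hcb : supp c ⊆ supp (b : RlfFactor M) := by
      intro 𝔮 h𝔮 hb𝔮
      have hprod : (a : RlfFactor M) 𝔮 * c 𝔮 = 1 := by rw [← Pi.mul_apply, ← hc]; exact hb𝔮
      exact h𝔮 ((isSharp_realification _).1 _ (IsUnit.of_mul_eq_one _ (by rw [mul_comm]; exact hprod)))
    exact ⟨⟨c, b', hcb.trans hb'⟩, Subtype.ext hc⟩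

end Literature.AlgebraicGeometry.Frobenioids
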